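import Summits.QuantumAdvantage.QuantumAdvantage.Theorems.LinnikCubicClassGroupsDegreeOnePrimesEscapeChebotarevElementRelative
import Summits.QuantumAdvantage.QuantumAdvantage.Theorems.LinnikCubicClassGroupsDegreeOnePrimesEscapeRamifiedJunk
import Literature.NumberTheory.GaloisRepresentations.FrobeniusDensityTheorem
import HarnessLib

/-!
# The least inert prime in a cyclic extension of an arbitrary number field

Topic `Summits/QuantumAdvantage/QuantumAdvantage/Theorems`, cell B2b-1 (linnik-cubic), PART A (gen 16); helper
toward the crux `DegreeOnePrimesEscape` (stmt-QuantumAdvantage-11543).  HONEST FRAMING: the value of this file is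
a THEOREM (kernel-checked, GRH-free) — NOT summit progress.

The case "`σ` a generator" of the Lagarias–Montgomery–Odlyzko theorem over an arbitrary base
(`exists_prime_isArithFrobAt_le_relative_discr_rpow`, `…ChebotarevElementRelative.lean`): a prime whose Frobenius
generates `Gal(N/F)` has decomposition group everything, hence (being unramified) residue degree `[N:F]` and a
single prime above it.

**Theorem** (`exists_inertPrime_absNorm_le_relative`).  For `n > 1` there is `L = L(n) > 0` such that for every CYCLIC
Galois extension `N/F` of number fields with `[N:ℚ] = n` there is a prime `𝔮` of `F`, of degree one over `ℚ`
(`N𝔮 = p` prime, `p ∤ d_N`), unramified in `N` and INERT in `N` (exactly one prime of `N` above it, of residue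
degree `[N:F]`), with `N𝔮 ≤ |d_N|^{L}`.  The tree's `…CyclicInertPrime.lean` (gen 8) is the case `F = ℚ`.
[LagariasMontgomeryOdlyzko1979, Theorem 1.1 with `C = {σ}`, `⟨σ⟩ = Gal(N/F)`].
-/

noncomputable section

open NumberField IsDedekindDomain Ideal MulAction
open scoped NumberField Classical Pointwise

namespace Summit.QuantumAdvantage.QuantumAdvantage.Theorems.DegreeOnePrimesEscape

open Literature.NumberTheory.LFunctions Literature.NumberTheory.GaloisRepresentations

/-- **A prime whose Frobenius generates the (cyclic) Galois group is inert**: if `N/F` is Galois, `𝔮` is unramified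
in `N`, `𝔔 ∣ 𝔮`, and an arithmetic Frobenius `σ` at `𝔔` generates `Gal(N/F)`, then `f(𝔔|𝔮) = [N:F]` and `𝔔` is the
only prime of `N` above `𝔮`. [folklore] -/
theorem inertiaDeg_eq_card_of_isArithFrobAt_generator {F N : Type} [Field F] [NumberField F] [Field N]
    [NumberField N] [Algebra F N] [IsGalois F N] {q : HeightOneSpectrum (𝓞 F)}
    (hunr : Algebra.IsUnramifiedIn (𝓞 N) q.asIdeal) {Q : Ideal (𝓞 N)} (hQ : Q ∈ q.asIdeal.primesOver (𝓞 N))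
    {σ : N ≃ₐ[F] N} (hσ : IsArithFrobAt (𝓞 F) σ Q) (hgen : ∀ g : N ≃ₐ[F] N, g ∈ Subgroup.zpowers σ) :
    Q.inertiaDeg (𝓞 F) = Nat.card (N ≃ₐ[F] N) ∧ (q.asIdeal.primesOver (𝓞 N)).ncard = 1 := by
  haveI := hQ.1
  haveI := hQ.2
  haveI : q.asIdeal.IsMaximal := q.isMaximal
  haveI : IsGaloisGroup (N ≃ₐ[F] N) (𝓞 F) (𝓞 N) := IsGaloisGroup.of_isFractionRing _ _ _ F N
  -- the decomposition group of `𝔔` is everything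
  have hstab : MulAction.stabilizer (N ≃ₐ[F] N) Q = ⊤ := by
    rw [eq_top_iff]
    intro g _
    have hz : Subgroup.zpowers σ ≤ MulAction.stabilizer (N ≃ₐ[F] N) Q :=
      (Subgroup.zpowers_le (G := N ≃ₐ[F] N)).mpr hσ.mem_stabilizer
    exact hz (hgen g)
  have hf : Q.inertiaDeg (𝓞 F) = Nat.card (N ≃ₐ[F] N) := by
    have h := Ideal.card_stabilizer_eq_card_inertia_mul_finrank (G := N ≃ₐ[F] N) q.asIdeal Q
    rw [hstab, Subgroup.card_top, inertia_eq_bot_of_isUnramifiedIn hunr hQ, Subgroup.card_bot, one_mul] at h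
    exact h.symm
  refine ⟨hf, ?_⟩
  -- fundamental identity: `#{𝔔' ∣ 𝔮} · e · f = |G|` with `e = 1`, `f = |G|`
  have hfund := Ideal.ncard_primesOver_mul_ramificationIdxIn_mul_inertiaDegIn q.asIdeal (𝓞 N) (N ≃ₐ[F] N)
  have he : q.asIdeal.ramificationIdxIn (𝓞 N) = 1 := by
    rw [Ideal.ramificationIdxIn_eq_ramificationIdx q.asIdeal Q (N ≃ₐ[F] N)]
    exact Ideal.ramificationIdx_eq_one_iff.mpr (hunr Q hQ.1 hQ.2)
  rw [he, one_mul, Ideal.inertiaDegIn_eq_inertiaDeg q.asIdeal Q (N ≃ₐ[F] N), hf] at hfund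
  have hG : 0 < Nat.card (N ≃ₐ[F] N) := Nat.card_pos
  exact Nat.eq_of_mul_eq_mul_right hG (by rw [hfund, one_mul])

/-- **The least inert prime in a cyclic extension of an arbitrary number field** (see the module docstring).
[cite: LagariasMontgomeryOdlyzko1979, Theorem 1.1] -/
theorem exists_inertPrime_absNorm_le_relative (n : ℕ) (hn : 1 < n) :
    ∃ L : ℝ, 0 < L ∧ ∀ (F N : Type) [Field F] [NumberField F] [Field N] [NumberField N] [Algebra F N]
      [IsGalois F N] [IsCyclic (N ≃ₐ[F] N)], Module.finrank ℚ N = n →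
        ∃ q : HeightOneSpectrum (𝓞 F), Algebra.IsUnramifiedIn (𝓞 N) q.asIdeal ∧
          (q.asIdeal.primesOver (𝓞 N)).ncard = 1 ∧
          (∀ Q : Ideal (𝓞 N), Q ∈ q.asIdeal.primesOver (𝓞 N) → Q.inertiaDeg (𝓞 F) = Module.finrank F N) ∧
          (Ideal.absNorm q.asIdeal).Prime ∧ ¬ ((Ideal.absNorm q.asIdeal : ℤ) ∣ NumberField.discr N) ∧
          (Ideal.absNorm q.asIdeal : ℝ) ≤ ((NumberField.discr N).natAbs : ℝ) ^ L := by
  obtain ⟨L, hL, hmain⟩ := exists_prime_isArithFrobAt_le_relative_discr_rpow n hn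
  refine ⟨L, hL, fun F N _ _ _ _ _ _ _ hNn ↦ ?_⟩
  obtain ⟨σ, hσ⟩ := IsCyclic.exists_generator (α := N ≃ₐ[F] N)
  obtain ⟨Q, hQmax, hfrob, -, -, hprime, hnd, hle⟩ := hmain F N hNn σ
  haveI := hQmax
  haveI : FiniteDimensional F N := Module.Finite.of_restrictScalars_finite ℚ F N
  have hq0 : Q.under (𝓞 F) ≠ ⊥ := by
    intro h0
    rw [h0, Ideal.absNorm_bot] at hprime
    exact Nat.not_prime_zero hprime
  set q : HeightOneSpectrum (𝓞 F) := ⟨Q.under (𝓞 F), Ideal.IsPrime.under (𝓞 F) Q, hq0⟩ with hq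
  have hQmem : Q ∈ q.asIdeal.primesOver (𝓞 N) := ⟨hQmax.isPrime, ⟨rfl⟩⟩
  have hunr : Algebra.IsUnramifiedIn (𝓞 N) q.asIdeal := by
    by_contra hram
    have hpq : ((Ideal.absNorm (Q.under (𝓞 F)) : ℕ) : 𝓞 F) ∈ q.asIdeal := Ideal.absNorm_mem _
    exact hnd (dvd_discr_of_not_isUnramifiedIn (N := N) q hprime hpq hram)
  obtain ⟨hf, hone⟩ := inertiaDeg_eq_card_of_isArithFrobAt_generator hunr hQmem hfrob hσ
  refine ⟨q, hunr, hone, fun Q' hQ' => ?_, hprime, hnd, hle⟩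
  haveI := hQ'.1
  haveI := hQ'.2
  haveI : q.asIdeal.IsMaximal := q.isMaximal
  haveI : IsGaloisGroup (N ≃ₐ[F] N) (𝓞 F) (𝓞 N) := IsGaloisGroup.of_isFractionRing _ _ _ F N
  rw [Ideal.inertiaDeg_eq_of_isGaloisGroup q.asIdeal Q' Q (N ≃ₐ[F] N), hf, IsGalois.card_aut_eq_finrank]

end Summit.QuantumAdvantage.QuantumAdvantage.Theorems.DegreeOnePrimesEscape

end
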